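import Literature.NumberTheory.PAdicHodge.CupLogInjectiveDeRham
import Literature.NumberTheory.PAdicHodge.HodgeTateUnramifiedWeights
import HarnessLib

/-!
# Tate-graded period rings, I: `Fil`-arithmetic of the uniformizer and the `Fil`-calculus on `B ⊗ V`

Topic `Literature/NumberTheory/PAdicHodge`; namespace `Literature.NumberTheory.PAdicHodge.TateGraded`.
THEOREMS ONLY over the tree's abstract period-ring data (`PeriodRingData`; no definition, no named
fact, no instance, no `sorry`). First of three files formalising, for an abstract period-ring datum
`𝔅 = (B, Γ ↷, E = B^Γ, Fil^•)` carrying the graded structure of `B_dR`, the FILTERED form of Fontaine's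
comparison isomorphism for admissible (= de Rham) representations — N. Wach, *Représentations
p-adiques potentiellement cristallines*, Bull. SMF 124 (1996) §B.2.3, proof of Prop. 2: « l'application
naturelle `B_dR ⊗_K D → Hom_{ℚ_p}(V, B_dR)` est un isomorphisme de `B_dR`-modules filtrés. Soit
`(u_1, …, u_d)` une base de `D` adaptée à la filtration […] On voit que `Hom_{ℚ_p}(V, B_dR⁺)` est le
`B_dR⁺`-module libre de base les `t^{-r_i} u_i` » (read for `V` in place of its dual: `B_dR ⊗ V` for
`Hom(V^*, B_dR)`).

## The abstract hypotheses ("Tate-graded" data; all hold for `B_dR(F)`, see the sequel files)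

For `𝔅 : PeriodRingData Γ P E`, an element `U : 𝔅.B` (for `B_dR`: `u = [ε] − 1`, Fontaine's uniformizer)
and a map `χ : Γ → E` (for `B_dR`: the cyclotomic character seen in `F`):
* `hU`   — `Fil^{i+1} = U · Fil^i`: `x ∈ Fil^{i+1} ↔ ∃ y ∈ Fil^i, x = U y`;
* `hχ`   — `σ U = k_σ U` with `k_σ ∈ Fil⁰` and `k_σ ≡ χ(σ) (mod Fil¹)` (`θ(σu/u) = χ(σ)`);
* `hχ0`  — `χ σ ≠ 0`;
* `hloc` — `Fil⁰` is local with maximal ideal `Fil¹`: `b ∈ Fil⁰ ∖ Fil¹` has an inverse in `Fil⁰`;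
* `hT0`  — Tate/Ax–Sen–Tate on `gr⁰ = Fil⁰/Fil¹ = ℂ`: `b ∈ Fil⁰` with `σ b ≡ b (mod Fil¹)` for all `σ` is
           `≡ e (mod Fil¹)` for some `e ∈ E` (`ℂ^Γ = E`);
* `hT1`  — Tate's twisted `H⁰`: `b ∈ Fil⁰` with `σ b ≡ χ(σ)^j b (mod Fil¹)` for all `σ`, `j ≠ 0`, lies in
           `Fil¹` (`ℂ(χ^j)^Γ = 0`).

## Contents (this file: only `hU` is used)

§1 `Fil`-arithmetic: `Fil⁰` is a subring containing `E` with `E ∩ Fil¹ = 0`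
(`eq_zero_of_algebraMap_mem_fil_one`), `U ≠ 0`, `U ∈ Fil¹`, **`Fil^{i+m} = U^m Fil^i`** (`mem_fil_add_iff`)
and cancellation `U^m y ∈ Fil^{i+m} ⇒ y ∈ Fil^i`. §2 the induced filtration `Fil^i(B ⊗ V) = Fil^i B ⊗ V`
(tree `PeriodRingData.filTensor`): decreasing, `Fil^j B · Fil^i(B ⊗ V) ⊆ Fil^{j+i}(B ⊗ V)`, `Γ`-stable, and
cancellation of `U^m` (in coordinates along a basis of `V`). The graded injectivity of the comparison map
and the filtered comparison theorem are in the sequels `TateGradedInjectivity`, `TateGradedComparison`.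

## References
* N. Wach, Bull. Soc. Math. France 124 (1996), §B.2.3, Prop. 2 and proof (p. 394). [Wach1996]
* J.-M. Fontaine, *Représentations p-adiques semi-stables*, Astérisque 223 (1994), Exp. III, Thm. 1.5.2
  (comparison isomorphism for admissible `V`), §1.5.4 (induced filtration). [FontaineAsterisque223III]
* L. Berger, *An introduction to the theory of p-adic representations* (2004), §II "p-adic Hodge theory",
  "Construction of B_dR": `Gr B_dR ≃ ⊕ ℂ_p(i)`, de Rham ⇒ Hodge–Tate, jumps of `Fil D_dR(V)` = minus the
  Hodge–Tate weights. [Berger2004Intro]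
-/

noncomputable section

open scoped TensorProduct
open TensorProduct

namespace Literature.NumberTheory.PAdicHodge.TateGraded

open Literature.NumberTheory.GaloisRepresentations
open Literature.NumberTheory.GaloisRepresentations.PeriodRingData

-- Mathlib's own global value; needed for instance problems on `𝔅.B ⊗[P] M` (see `PAdicHodgeProofs`).
set_option maxSynthPendingDepth 3

universe u v v' w w'

variable {Γ : Type u} [Group Γ] {P : Type v} {E : Type v'} [Field P] [Field E] [Algebra P E]
  {M : Type w'} [AddCommGroup M] [Module P M]
  (𝔅 : PeriodRingData.{u, v, v', w} Γ P E) {U : 𝔅.B} {χ : Γ → E}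

/-! ## §1 `Fil`-arithmetic of the uniformizer `U` -/

section FilArith

/-- `Fil⁰` is closed under multiplication. [cite: FontaineAsterisque223III, Exp. II §1.5.5 (Fil^i B_dR = t^i B_dR⁺, t a uniformizer of the DVR B_dR⁺)] -/
theorem mul_mem_fil_zero {x y : 𝔅.B} (hx : x ∈ 𝔅.fil 0) (hy : y ∈ 𝔅.fil 0) : x * y ∈ 𝔅.fil 0 := by
  simpa only [add_zero] using 𝔅.mul_mem_fil 0 0 x y hx hy

/-- `Fil⁰ · Fil^i ⊆ Fil^i`. [cite: FontaineAsterisque223III, Exp. II §1.5.5 (Fil^i B_dR = t^i B_dR⁺, t a uniformizer of the DVR B_dR⁺)] -/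
theorem mul_mem_fil_of_mem_fil_zero {x y : 𝔅.B} (i : ℤ) (hx : x ∈ 𝔅.fil 0) (hy : y ∈ 𝔅.fil i) :
    x * y ∈ 𝔅.fil i := by
  simpa only [zero_add] using 𝔅.mul_mem_fil 0 i x y hx hy

/-- Powers of elements of `Fil⁰` lie in `Fil⁰`. [cite: FontaineAsterisque223III, Exp. II §1.5.5 (Fil^i B_dR = t^i B_dR⁺, t a uniformizer of the DVR B_dR⁺)] -/
theorem pow_mem_fil_zero {x : 𝔅.B} (hx : x ∈ 𝔅.fil 0) (n : ℕ) : x ^ n ∈ 𝔅.fil 0 := by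
  induction n with
  | zero => rw [pow_zero]; exact 𝔅.one_mem_fil_zero
  | succ n ih => rw [pow_succ]; exact mul_mem_fil_zero 𝔅 ih hx

/-- Scalars from `E` lie in `Fil⁰`. [cite: FontaineAsterisque223III, Exp. II §1.5.5 (Fil^i B_dR = t^i B_dR⁺, t a uniformizer of the DVR B_dR⁺)] -/
theorem algebraMap_mem_fil_zero (e : E) : algebraMap E 𝔅.B e ∈ 𝔅.fil 0 := by
  rw [Algebra.algebraMap_eq_smul_one]
  exact Submodule.smul_mem _ e 𝔅.one_mem_fil_zero

/-- **`E ∩ Fil¹ = 0`**: a scalar lying in `Fil¹` vanishes (else `1 ∈ Fil¹`, so `Fil^i ⊆ Fil^{i+1}` for all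
`i` and `1 ∈ ⋂ Fil^i = 0`). [cite: FontaineAsterisque223III, Exp. II §1.5.5 (Fil^i B_dR = t^i B_dR⁺, t a uniformizer of the DVR B_dR⁺)] -/
theorem eq_zero_of_algebraMap_mem_fil_one {e : E} (he : algebraMap E 𝔅.B e ∈ 𝔅.fil 1) : e = 0 := by
  by_contra hne
  have h1 : (1 : 𝔅.B) ∈ 𝔅.fil 1 := by
    have := Submodule.smul_mem _ e⁻¹ he
    rwa [Algebra.algebraMap_eq_smul_one, smul_smul, inv_mul_cancel₀ hne, one_smul] at this
  -- every stage contains the next one's complement: `Fil^i ⊆ Fil^{i+1}`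
  have hstep : ∀ (i : ℤ) (x : 𝔅.B), x ∈ 𝔅.fil i → x ∈ 𝔅.fil (i + 1) := fun i x hx => by
    simpa only [mul_one] using 𝔅.mul_mem_fil i 1 x 1 hx h1
  have hall : ∀ i : ℤ, (1 : 𝔅.B) ∈ 𝔅.fil i := by
    intro i
    rcases le_or_gt i 1 with hi | hi
    · exact 𝔅.fil_antitone hi h1
    · -- climb from `1` to `i`
      obtain ⟨n, rfl⟩ := Int.le.dest hi.le
      clear hi
      induction n with
      | zero => simpa using h1
      | succ n ih => simpa only [Nat.cast_succ, ← add_assoc] using hstep _ _ ih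
  have hbot : (1 : 𝔅.B) ∈ (⨅ i, 𝔅.fil i) := (Submodule.mem_iInf _).2 hall
  rw [𝔅.iInf_fil, Submodule.mem_bot] at hbot
  exact one_ne_zero hbot

variable (hU : ∀ (i : ℤ) (x : 𝔅.B), x ∈ 𝔅.fil (i + 1) ↔ ∃ y ∈ 𝔅.fil i, x = U * y)
include hU

/-- `U ∈ Fil¹`. [cite: FontaineAsterisque223III, Exp. II §1.5.5 (Fil^i B_dR = t^i B_dR⁺, t a uniformizer of the DVR B_dR⁺)] -/
theorem unif_mem_fil_one : U ∈ 𝔅.fil 1 := by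
  have h := (hU 0 U).2 ⟨1, 𝔅.one_mem_fil_zero, (mul_one U).symm⟩
  simpa using h

/-- `U ≠ 0` (as `1 ∈ Fil⁰ = U · Fil^{-1}`). [cite: FontaineAsterisque223III, Exp. II §1.5.5 (Fil^i B_dR = t^i B_dR⁺, t a uniformizer of the DVR B_dR⁺)] -/
theorem unif_ne_zero : U ≠ 0 := by
  intro hU0
  have h1 : (1 : 𝔅.B) ∈ 𝔅.fil ((-1 : ℤ) + 1) := by simpa using 𝔅.one_mem_fil_zero
  obtain ⟨y, -, hy⟩ := (hU (-1) 1).1 h1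
  rw [hU0, zero_mul] at hy
  exact one_ne_zero hy

/-- **`Fil^{i+m} = U^m · Fil^i`.** [cite: FontaineAsterisque223III, Exp. II §1.5.5 (Fil^i B_dR = t^i B_dR⁺, t a uniformizer of the DVR B_dR⁺)] -/
theorem mem_fil_add_iff (i : ℤ) (m : ℕ) (x : 𝔅.B) :
    x ∈ 𝔅.fil (i + m) ↔ ∃ y ∈ 𝔅.fil i, x = U ^ m * y := by
  induction m generalizing x with
  | zero => simp
  | succ m ih =>
    rw [Nat.cast_succ, ← add_assoc, hU]
    constructor
    · rintro ⟨y, hy, rfl⟩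
      obtain ⟨z, hz, rfl⟩ := (ih y).1 hy
      exact ⟨z, hz, by ring⟩
    · rintro ⟨z, hz, rfl⟩
      exact ⟨U ^ m * z, (ih _).2 ⟨z, hz, rfl⟩, by ring⟩

/-- `U^m · Fil^i ⊆ Fil^{i+m}`. [cite: FontaineAsterisque223III, Exp. II §1.5.5 (Fil^i B_dR = t^i B_dR⁺, t a uniformizer of the DVR B_dR⁺)] -/
theorem pow_mul_mem_fil {i : ℤ} (m : ℕ) {y : 𝔅.B} (hy : y ∈ 𝔅.fil i) : U ^ m * y ∈ 𝔅.fil (i + m) :=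
  (mem_fil_add_iff 𝔅 hU i m _).2 ⟨y, hy, rfl⟩

/-- **Cancellation of `U`**: `U^m y ∈ Fil^{i+m} ⇒ y ∈ Fil^i` (`B` is a domain). [cite: FontaineAsterisque223III, Exp. II §1.5.5 (Fil^i B_dR = t^i B_dR⁺, t a uniformizer of the DVR B_dR⁺)] -/
theorem mem_fil_of_pow_mul_mem {i : ℤ} (m : ℕ) {y : 𝔅.B} (h : U ^ m * y ∈ 𝔅.fil (i + m)) :
    y ∈ 𝔅.fil i := by
  obtain ⟨z, hz, hyz⟩ := (mem_fil_add_iff 𝔅 hU i m _).1 h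
  have hUm : U ^ m ≠ 0 := pow_ne_zero _ (unif_ne_zero 𝔅 hU)
  rw [mul_right_injective₀ hUm hyz]
  exact hz

end FilArith

/-! ## §2 `Fil`-calculus on `B ⊗ V` -/

section FilTensor

/-- The filtration `Fil^i(B ⊗ V)` is decreasing. [cite: FontaineAsterisque223III, Exp. III §1.5.4 (the induced filtration on B ⊗ V and on D_B(V))] -/
theorem filTensor_antitone : Antitone (𝔅.filTensor M) := by
  intro i j hij x hx
  obtain ⟨y, rfl⟩ := hx
  refine ⟨AlgebraTensorModule.map (Submodule.inclusion (𝔅.fil_antitone hij)) LinearMap.id y, ?_⟩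
  rw [← LinearMap.comp_apply, ← AlgebraTensorModule.map_comp]
  rfl

/-- **`Fil^j B · Fil^i(B ⊗ V) ⊆ Fil^{j+i}(B ⊗ V)`.** [cite: FontaineAsterisque223III, Exp. III §1.5.4 (the induced filtration on B ⊗ V and on D_B(V))] -/
theorem smul_mem_filTensor {j i : ℤ} {b : 𝔅.B} (hb : b ∈ 𝔅.fil j) {x : 𝔅.B ⊗[P] M}
    (hx : x ∈ 𝔅.filTensor M i) : b • x ∈ 𝔅.filTensor M (j + i) := by
  obtain ⟨y, rfl⟩ := hx
  induction y using TensorProduct.induction_on with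
  | zero => rw [map_zero, smul_zero]; exact Submodule.zero_mem _
  | tmul f m =>
    rw [AlgebraTensorModule.map_tmul, Submodule.subtype_apply, LinearMap.id_apply, smul_tmul', smul_eq_mul]
    exact ⟨(⟨b * f, 𝔅.mul_mem_fil j i b f hb f.2⟩ : 𝔅.fil (j + i)) ⊗ₜ[P] m, by
      rw [AlgebraTensorModule.map_tmul]; rfl⟩
  | add y z hy hz => rw [map_add, smul_add]; exact Submodule.add_mem _ hy hz

/-- `Fil⁰ B · Fil^i(B ⊗ V) ⊆ Fil^i(B ⊗ V)`. [cite: FontaineAsterisque223III, Exp. III §1.5.4 (the induced filtration on B ⊗ V and on D_B(V))] -/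
theorem smul_mem_filTensor_of_mem_fil_zero {i : ℤ} {b : 𝔅.B} (hb : b ∈ 𝔅.fil 0) {x : 𝔅.B ⊗[P] M}
    (hx : x ∈ 𝔅.filTensor M i) : b • x ∈ 𝔅.filTensor M i := by
  simpa only [zero_add] using smul_mem_filTensor 𝔅 hb hx

/-- **`Fil^i(B ⊗ V)` is `Γ`-stable** under the diagonal action. [cite: FontaineAsterisque223III, Exp. III §1.5.4 (the induced filtration on B ⊗ V and on D_B(V))] -/
theorem tensorRep_mem_filTensor [TopologicalSpace Γ] [TopologicalSpace P] [TopologicalSpace M]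
    (ρ : ContinuousRep Γ P M) (σ : Γ) {i : ℤ} {x : 𝔅.B ⊗[P] M} (hx : x ∈ 𝔅.filTensor M i) :
    𝔅.tensorRep ρ σ x ∈ 𝔅.filTensor M i := by
  obtain ⟨y, rfl⟩ := hx
  induction y using TensorProduct.induction_on with
  | zero => rw [map_zero, map_zero]; exact Submodule.zero_mem _
  | tmul f m =>
    rw [AlgebraTensorModule.map_tmul, Submodule.subtype_apply, LinearMap.id_apply, tensorRep_apply_tmul]
    exact ⟨(⟨σ • (f : 𝔅.B), 𝔅.smul_mem_fil σ i f f.2⟩ : 𝔅.fil i) ⊗ₜ[P] ρ σ m, by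
      rw [AlgebraTensorModule.map_tmul]; rfl⟩
  | add y z hy hz => rw [map_add, map_add]; exact Submodule.add_mem _ hy hz

variable (hU : ∀ (i : ℤ) (x : 𝔅.B), x ∈ 𝔅.fil (i + 1) ↔ ∃ y ∈ 𝔅.fil i, x = U * y)
include hU

/-- **Cancellation of `U` on `B ⊗ V`**: `U^m x ∈ Fil^{i+m}(B ⊗ V) ⇒ x ∈ Fil^i(B ⊗ V)` (read in coordinates
along a `P`-basis of the finite-dimensional `V`). [cite: FontaineAsterisque223III, Exp. III §1.5.4 (the induced filtration on B ⊗ V and on D_B(V))] -/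
theorem mem_filTensor_of_pow_smul_mem [Module.Finite P M] {i : ℤ} (m : ℕ) {x : 𝔅.B ⊗[P] M}
    (h : (U ^ m) • x ∈ 𝔅.filTensor M (i + m)) : x ∈ 𝔅.filTensor M i := by
  classical
  let bM := Module.finBasis P M
  obtain ⟨g, rfl⟩ := TensorProduct.eq_repr_basis_right bM x
  have hsum : (g.sum fun k c => c ⊗ₜ[P] bM k) = ∑ k, g k ⊗ₜ[P] bM k :=
    Finsupp.sum_fintype _ _ fun k => by rw [zero_tmul]
  rw [hsum] at h ⊢
  have h' : ∑ k, (U ^ m * g k) ⊗ₜ[P] bM k ∈ 𝔅.filTensor M (i + m) := by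
    rw [Finset.smul_sum] at h
    simpa only [smul_tmul', smul_eq_mul] using h
  exact 𝔅.sum_tmul_mem_filTensor bM fun k =>
    mem_fil_of_pow_mul_mem 𝔅 hU m (𝔅.mem_fil_of_sum_tmul_mem_filTensor bM h' k)

end FilTensor

end Literature.NumberTheory.PAdicHodge.TateGraded

end
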